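import Summits.AnomalousDissipation.AnomalousDissipation.Theorems.SolenoidalFractalHomogenisationLagrangianStepVmodIterate
import HarnessLib

/-!
# K1L_D (stmt-AnomalousDissipation-27980): (V_mod) flat stage, block (sf) — THE AMPLITUDE ITERATION ON THE PERIOD GRID
# (the (sf)/(fs) twin of `VmodGen.iterate_defect_le`, abstract propagator level; prover ad-k3l-bookkeeping-p1 g10, (sf) owner by RULING D28-5;
#  helper `--supports 27980 --as helper`)

Same abstract setting as `…VmodIterate` (prover ad-sawtooth-k1loc-p1 g15): two families of window maps `U, T` on `V2` with the cocycle
property, a grid `s_j = s₀ + j·t₁`, a slow label `ℓ ≠ 0`, a class predicate `CP` preserved by `U`, and the one-step tools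
`hV1` ((V) un-squared on pair data), `hLk` (slow leakage of fast class data), `hFs` (fast content after one grid step, constants `cS, κ`),
`hTθ`/`hT1` (coarse decay/contraction at the label), plus ONE more shape the in-window sideband needs:
* `hFw` — fast content INSIDE a grid window: `√(fast(U(s_j,t) y)) ≤ cS·‖y‖ + √(fast y)` for `t ∈ [s_j, s_{j+1}]` (the `κ ≤ 1` reading of
  `VmodGen.sqrt_fast_le`, whose kill factor `exp(−π²·lo·(t−s)/2)` is `≤ 1`).
What differs from `iterate_defect_le`: the INITIAL STATE is a GENERAL weakly divergence-free class datum `y` (slow amplitude `≤ A 0`, fast content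
`≤ F 0`) — the head window of a general-phase (sf)/(fs) window deposits such a state at the first grid point — and the conclusions are the AMPLITUDES,
not the defect: for majorising sequences `A, F ≥ 0` of the recursion `α_{j+1} ≤ (θ+cV)α_j + cL·φ_j`, `φ_{j+1} ≤ √2·cS·α_j + (cS+κ)φ_j`,

* `iterate_amplitude_grid_le` — at the grid points: `CP (U(s₀,s_j)y)`, `‖𝓕(U(s₀,s_j)y)(ℓ)‖ ≤ A j`, `√(fast(U(s₀,s_j)y)) ≤ F j`;
* **`iterate_amplitude_le`** — inside `[s_j, s_{j+1}]`: slow amplitude `‖𝓕(U(s₀,t)y)(ℓ)‖ ≤ (1+cV)·A j + cL·F j` and SIDEBAND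
  `√(fast(U(s₀,t)y)) ≤ √2·cS·A j + (cS+1)·F j`.
The geometric majorants and the constants of the certifier's table (`Lines/onelevel-ss-regimes.md` §2 T-I / L-sb, §4 (sf)) are the business of the
(sf) coarse-row file; the dischargers of `hV1`/`hLk`/`hFs`/`hFw`/`hTθ`/`hT1` are p1 g15's (`…VmodPairV`, `…VmodLeakSlow`, `…VmodLeakEnergy`,
`…VmodCoarseDecay`).  `sorry`-free; NOT a proof of (sf), of the stub, of K1L_D or of AD; rung F-D1.A0.
-/

set_option linter.dupNamespace false

noncomputable section

namespace Summit.AnomalousDissipation.AnomalousDissipation.Theorems.SolenoidalFractalHomogenisation.LagrangianStep.VmodGen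

open Set MeasureTheory Complex UnitAddTorus
open scoped InnerProductSpace ENNReal
open Literature.Analysis Literature.Analysis.FunctionSpaces Literature.Analysis.FunctionSpaces.Torus
open Literature.Analysis.FluidPDE Literature.Analysis.FluidPDE.Torus
open Summit.AnomalousDissipation.AnomalousDissipation.Theorems.SolenoidalFractalHomogenisation.LagrangianStep.VmodFlat (fc fc_sub)

section Iterate

variable {U T : ℝ → ℝ → (V2 →L[ℝ] V2)} {Tw s₀ t₁ : ℝ} {ℓ : Fin 3 → ℤ} {CP : V2 → Prop} {θ cV cL cS κ : ℝ}

set_option maxHeartbeats 1600000 in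
/-- **THE AMPLITUDE INVARIANT AT THE GRID POINTS** (general class-pair initial state).  See the module docstring. -/
theorem iterate_amplitude_grid_le (hℓ : ℓ ≠ 0) (hs₀ : 0 ≤ s₀) (ht₁ : 0 < t₁)
    (hUcomp : ∀ s t r, 0 ≤ s → s ≤ t → t ≤ r → r ≤ Tw → ∀ y : V2, U t r (U s t y) = U s r y)
    (hUdf : ∀ s t (y : V2), U s t y ∈ divFreeL2 (Fin 3))
    (hUcl : ∀ s t, 0 ≤ s → s ≤ t → t ≤ Tw → ∀ y : V2, y ∈ divFreeL2 (Fin 3) → CP y → CP (U s t y))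
    (hCPoff : ∀ y f : V2, CP y → (∀ k, k ≠ ℓ → k ≠ -ℓ → fc f k = fc y k) → fc f ℓ = 0 → fc f (-ℓ) = 0 → CP f)
    (hθ : 0 ≤ θ) (hcV : 0 ≤ cV) (hcL : 0 ≤ cL) (hcS : 0 ≤ cS) (hκ : 0 ≤ κ)
    (hV1 : ∀ j : ℕ, ∀ t, s₀ + j * t₁ ≤ t → t ≤ s₀ + (j + 1) * t₁ → t ≤ Tw → ∀ a : V2, a ∈ divFreeL2 (Fin 3) →
      (∀ k, k ≠ ℓ → k ≠ -ℓ → fc a k = 0) → ‖fc (U (s₀ + j * t₁) t a - T (s₀ + j * t₁) t a) ℓ‖ ≤ cV * ‖fc a ℓ‖)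
    (hLk : ∀ j : ℕ, ∀ t, s₀ + j * t₁ ≤ t → t ≤ s₀ + (j + 1) * t₁ → t ≤ Tw → ∀ f : V2, f ∈ divFreeL2 (Fin 3) → CP f →
      fc f ℓ = 0 → fc f (-ℓ) = 0 → ‖fc (U (s₀ + j * t₁) t f) ℓ‖ ≤ cL * ‖f‖)
    (hFs : ∀ j : ℕ, s₀ + (j + 1) * t₁ ≤ Tw → ∀ y : V2, y ∈ divFreeL2 (Fin 3) → CP y →
      Real.sqrt (‖U (s₀ + j * t₁) (s₀ + (j + 1) * t₁) y‖ ^ 2 -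
          (‖fc (U (s₀ + j * t₁) (s₀ + (j + 1) * t₁) y) ℓ‖ ^ 2 + ‖fc (U (s₀ + j * t₁) (s₀ + (j + 1) * t₁) y) (-ℓ)‖ ^ 2))
        ≤ cS * ‖y‖ + κ * Real.sqrt (‖y‖ ^ 2 - (‖fc y ℓ‖ ^ 2 + ‖fc y (-ℓ)‖ ^ 2)))
    (hTθ : ∀ j : ℕ, s₀ + (j + 1) * t₁ ≤ Tw → ∀ y : V2, y ∈ divFreeL2 (Fin 3) →
      ‖fc (T (s₀ + j * t₁) (s₀ + (j + 1) * t₁) y) ℓ‖ ≤ θ * ‖fc y ℓ‖)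
    (y : V2) (hCPy : CP y) (hU0 : U s₀ s₀ y = y)
    (A F : ℕ → ℝ) (hA0 : ‖fc y ℓ‖ ≤ A 0)
    (hF0 : Real.sqrt (‖y‖ ^ 2 - (‖fc y ℓ‖ ^ 2 + ‖fc y (-ℓ)‖ ^ 2)) ≤ F 0)
    (hArec : ∀ j, (θ + cV) * A j + cL * F j ≤ A (j + 1)) (hFrec : ∀ j, Real.sqrt 2 * cS * A j + (cS + κ) * F j ≤ F (j + 1)) :
    ∀ j : ℕ, s₀ + j * t₁ ≤ Tw →
      CP (U s₀ (s₀ + j * t₁) y) ∧ ‖fc (U s₀ (s₀ + j * t₁) y) ℓ‖ ≤ A j ∧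
      Real.sqrt (‖U s₀ (s₀ + j * t₁) y‖ ^ 2 - (‖fc (U s₀ (s₀ + j * t₁) y) ℓ‖ ^ 2 + ‖fc (U s₀ (s₀ + j * t₁) y) (-ℓ)‖ ^ 2)) ≤ F j := by
  intro j
  induction j with
  | zero =>
      intro _
      simp only [Nat.cast_zero, zero_mul, add_zero, hU0]
      exact ⟨hCPy, hA0, hF0⟩
  | succ j ih =>
      intro hj1
      have hcast : ((j + 1 : ℕ) : ℝ) = (j : ℝ) + 1 := by push_cast; ring
      rw [hcast] at hj1 ⊢
      have hj0 : s₀ + j * t₁ ≤ Tw := by nlinarith [ht₁]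
      obtain ⟨hCPz, hα, hφ⟩ := ih hj0
      set sj : ℝ := s₀ + j * t₁ with hsj
      set sj1 : ℝ := s₀ + (j + 1) * t₁ with hsj1
      have hsj0 : 0 ≤ sj := by rw [hsj]; positivity
      have hs0j : s₀ ≤ sj := by rw [hsj]; nlinarith [ht₁]
      have hjj1 : sj ≤ sj1 := by rw [hsj, hsj1]; nlinarith [ht₁]
      set z : V2 := U s₀ sj y with hz
      have hzdf : z ∈ divFreeL2 (Fin 3) := hUdf _ _ _
      -- split the state
      obtain ⟨a, f, hzaf, hadf, hfdf, haoff, haℓ, -, hf1, hf2, hfoff, -, hnf⟩ := exists_pair_split hℓ z hzdf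
      have hCPf : CP f := hCPoff z f hCPz hfoff hf1 hf2
      have hfnorm : ‖f‖ = Real.sqrt (‖z‖ ^ 2 - (‖fc z ℓ‖ ^ 2 + ‖fc z (-ℓ)‖ ^ 2)) := by
        rw [← hnf, Real.sqrt_sq (norm_nonneg _)]
      have hφ' : ‖f‖ ≤ F j := by rw [hfnorm]; exact hφ
      -- cocycle
      have hz1 : U s₀ sj1 y = U sj sj1 z := by rw [hz, hUcomp s₀ sj sj1 hs₀ hs0j hjj1 hj1]
      have hUz : U sj sj1 z = U sj sj1 a + U sj sj1 f := by rw [hzaf, map_add]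
      -- one-step estimates
      have e1 : ‖fc (U sj sj1 a - T sj sj1 a) ℓ‖ ≤ cV * ‖fc a ℓ‖ := hV1 j sj1 hjj1 le_rfl hj1 a hadf haoff
      have e2 : ‖fc (U sj sj1 f) ℓ‖ ≤ cL * ‖f‖ := hLk j sj1 hjj1 le_rfl hj1 f hfdf hCPf hf1 hf2
      have e3 : ‖fc (T sj sj1 a) ℓ‖ ≤ θ * ‖fc a ℓ‖ := hTθ j hj1 a hadf
      refine ⟨?_, ?_, ?_⟩
      · rw [hz1]; exact hUcl sj sj1 hsj0 hjj1 hj1 z hzdf hCPz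
      · rw [hz1, hUz, fc_add]
        have hsplit : fc (U sj sj1 a) ℓ = fc (T sj sj1 a) ℓ + fc (U sj sj1 a - T sj sj1 a) ℓ := by rw [fc_sub]; abel
        calc ‖fc (U sj sj1 a) ℓ + fc (U sj sj1 f) ℓ‖ ≤ ‖fc (U sj sj1 a) ℓ‖ + ‖fc (U sj sj1 f) ℓ‖ := norm_add_le _ _
          _ ≤ (‖fc (T sj sj1 a) ℓ‖ + ‖fc (U sj sj1 a - T sj sj1 a) ℓ‖) + cL * ‖f‖ := by
              rw [hsplit]; exact add_le_add (norm_add_le _ _) e2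
          _ ≤ (θ * ‖fc a ℓ‖ + cV * ‖fc a ℓ‖) + cL * F j := add_le_add (add_le_add e3 e1) (mul_le_mul_of_nonneg_left hφ' hcL)
          _ = (θ + cV) * ‖fc z ℓ‖ + cL * F j := by rw [haℓ]; ring
          _ ≤ (θ + cV) * A j + cL * F j := by nlinarith [mul_le_mul_of_nonneg_left hα (add_nonneg hθ hcV)]
          _ ≤ A (j + 1) := hArec j
      · rw [hz1]
        have h1 := hFs j hj1 z hzdf hCPz
        have h2 : ‖z‖ ≤ Real.sqrt 2 * ‖fc z ℓ‖ + Real.sqrt (‖z‖ ^ 2 - (‖fc z ℓ‖ ^ 2 + ‖fc z (-ℓ)‖ ^ 2)) :=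
          norm_le_sqrt_two_mul_add_sqrt hℓ z
        calc _ ≤ cS * ‖z‖ + κ * Real.sqrt (‖z‖ ^ 2 - (‖fc z ℓ‖ ^ 2 + ‖fc z (-ℓ)‖ ^ 2)) := h1
          _ ≤ cS * (Real.sqrt 2 * A j + F j) + κ * F j := by
              have h3 : ‖z‖ ≤ Real.sqrt 2 * A j + F j :=
                h2.trans (add_le_add (mul_le_mul_of_nonneg_left hα (Real.sqrt_nonneg 2)) hφ)
              nlinarith [mul_le_mul_of_nonneg_left h3 hcS, mul_le_mul_of_nonneg_left hφ hκ]
          _ = Real.sqrt 2 * cS * A j + (cS + κ) * F j := by ring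
          _ ≤ F (j + 1) := hFrec j

set_option maxHeartbeats 1600000 in
/-- **THE AMPLITUDE ITERATION (in-window conclusions).**  Under the hypotheses of `iterate_amplitude_grid_le` and the in-window fast-content shape
`hFw` and (V)/leak shapes on partial windows (`hV1`, `hLk`, already stated for `t ∈ [s_j, s_{j+1}]`) and the coarse contraction `hT1`:
for `t ∈ [s_j, s_{j+1}]`, `t ≤ Tw`,
`‖𝓕(U(s₀,t)y)(ℓ)‖ ≤ (1+cV)·A j + cL·F j`  and  `√(‖U(s₀,t)y‖² − ‖𝓕(U(s₀,t)y)(ℓ)‖² − ‖𝓕(U(s₀,t)y)(−ℓ)‖²) ≤ √2·cS·A j + (cS+1)·F j`. -/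
theorem iterate_amplitude_le (hℓ : ℓ ≠ 0) (hs₀ : 0 ≤ s₀) (ht₁ : 0 < t₁)
    (hUcomp : ∀ s t r, 0 ≤ s → s ≤ t → t ≤ r → r ≤ Tw → ∀ y : V2, U t r (U s t y) = U s r y)
    (hUdf : ∀ s t (y : V2), U s t y ∈ divFreeL2 (Fin 3))
    (hUcl : ∀ s t, 0 ≤ s → s ≤ t → t ≤ Tw → ∀ y : V2, y ∈ divFreeL2 (Fin 3) → CP y → CP (U s t y))
    (hCPoff : ∀ y f : V2, CP y → (∀ k, k ≠ ℓ → k ≠ -ℓ → fc f k = fc y k) → fc f ℓ = 0 → fc f (-ℓ) = 0 → CP f)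
    (hθ : 0 ≤ θ) (hcV : 0 ≤ cV) (hcL : 0 ≤ cL) (hcS : 0 ≤ cS) (hκ : 0 ≤ κ)
    (hV1 : ∀ j : ℕ, ∀ t, s₀ + j * t₁ ≤ t → t ≤ s₀ + (j + 1) * t₁ → t ≤ Tw → ∀ a : V2, a ∈ divFreeL2 (Fin 3) →
      (∀ k, k ≠ ℓ → k ≠ -ℓ → fc a k = 0) → ‖fc (U (s₀ + j * t₁) t a - T (s₀ + j * t₁) t a) ℓ‖ ≤ cV * ‖fc a ℓ‖)
    (hLk : ∀ j : ℕ, ∀ t, s₀ + j * t₁ ≤ t → t ≤ s₀ + (j + 1) * t₁ → t ≤ Tw → ∀ f : V2, f ∈ divFreeL2 (Fin 3) → CP f →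
      fc f ℓ = 0 → fc f (-ℓ) = 0 → ‖fc (U (s₀ + j * t₁) t f) ℓ‖ ≤ cL * ‖f‖)
    (hFs : ∀ j : ℕ, s₀ + (j + 1) * t₁ ≤ Tw → ∀ y : V2, y ∈ divFreeL2 (Fin 3) → CP y →
      Real.sqrt (‖U (s₀ + j * t₁) (s₀ + (j + 1) * t₁) y‖ ^ 2 -
          (‖fc (U (s₀ + j * t₁) (s₀ + (j + 1) * t₁) y) ℓ‖ ^ 2 + ‖fc (U (s₀ + j * t₁) (s₀ + (j + 1) * t₁) y) (-ℓ)‖ ^ 2))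
        ≤ cS * ‖y‖ + κ * Real.sqrt (‖y‖ ^ 2 - (‖fc y ℓ‖ ^ 2 + ‖fc y (-ℓ)‖ ^ 2)))
    (hFw : ∀ j : ℕ, ∀ t, s₀ + j * t₁ ≤ t → t ≤ s₀ + (j + 1) * t₁ → t ≤ Tw → ∀ y : V2, y ∈ divFreeL2 (Fin 3) → CP y →
      Real.sqrt (‖U (s₀ + j * t₁) t y‖ ^ 2 - (‖fc (U (s₀ + j * t₁) t y) ℓ‖ ^ 2 + ‖fc (U (s₀ + j * t₁) t y) (-ℓ)‖ ^ 2))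
        ≤ cS * ‖y‖ + Real.sqrt (‖y‖ ^ 2 - (‖fc y ℓ‖ ^ 2 + ‖fc y (-ℓ)‖ ^ 2)))
    (hTθ : ∀ j : ℕ, s₀ + (j + 1) * t₁ ≤ Tw → ∀ y : V2, y ∈ divFreeL2 (Fin 3) →
      ‖fc (T (s₀ + j * t₁) (s₀ + (j + 1) * t₁) y) ℓ‖ ≤ θ * ‖fc y ℓ‖)
    (hT1 : ∀ s t, 0 ≤ s → s ≤ t → t ≤ Tw → ∀ y : V2, y ∈ divFreeL2 (Fin 3) → ‖fc (T s t y) ℓ‖ ≤ ‖fc y ℓ‖)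
    (y : V2) (hCPy : CP y) (hU0 : U s₀ s₀ y = y)
    (A F : ℕ → ℝ) (hA0 : ‖fc y ℓ‖ ≤ A 0)
    (hF0 : Real.sqrt (‖y‖ ^ 2 - (‖fc y ℓ‖ ^ 2 + ‖fc y (-ℓ)‖ ^ 2)) ≤ F 0)
    (hArec : ∀ j, (θ + cV) * A j + cL * F j ≤ A (j + 1)) (hFrec : ∀ j, Real.sqrt 2 * cS * A j + (cS + κ) * F j ≤ F (j + 1)) :
    ∀ j : ℕ, ∀ t, s₀ + j * t₁ ≤ t → t ≤ s₀ + (j + 1) * t₁ → t ≤ Tw →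
      ‖fc (U s₀ t y) ℓ‖ ≤ (1 + cV) * A j + cL * F j ∧
      Real.sqrt (‖U s₀ t y‖ ^ 2 - (‖fc (U s₀ t y) ℓ‖ ^ 2 + ‖fc (U s₀ t y) (-ℓ)‖ ^ 2)) ≤ Real.sqrt 2 * cS * A j + (cS + 1) * F j := by
  have inv := iterate_amplitude_grid_le hℓ hs₀ ht₁ hUcomp hUdf hUcl hCPoff hθ hcV hcL hcS hκ hV1 hLk hFs hTθ y hCPy hU0
    A F hA0 hF0 hArec hFrec
  intro j t hjt htj1 htT
  have hj0 : s₀ + j * t₁ ≤ Tw := hjt.trans htT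
  obtain ⟨hCPz, hα, hφ⟩ := inv j hj0
  set sj : ℝ := s₀ + j * t₁ with hsj
  have hsj0 : 0 ≤ sj := by rw [hsj]; positivity
  have hs0j : s₀ ≤ sj := by rw [hsj]; nlinarith [ht₁]
  set z : V2 := U s₀ sj y with hz
  have hzdf : z ∈ divFreeL2 (Fin 3) := hUdf _ _ _
  obtain ⟨a, f, hzaf, hadf, hfdf, haoff, haℓ, -, hf1, hf2, hfoff, -, hnf⟩ := exists_pair_split hℓ z hzdf
  have hCPf : CP f := hCPoff z f hCPz hfoff hf1 hf2
  have hfnorm : ‖f‖ = Real.sqrt (‖z‖ ^ 2 - (‖fc z ℓ‖ ^ 2 + ‖fc z (-ℓ)‖ ^ 2)) := by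
    rw [← hnf, Real.sqrt_sq (norm_nonneg _)]
  have hφ' : ‖f‖ ≤ F j := by rw [hfnorm]; exact hφ
  have hzt : U s₀ t y = U sj t z := by rw [hz, hUcomp s₀ sj t hs₀ hs0j hjt htT]
  refine ⟨?_, ?_⟩
  · -- slow amplitude inside the window
    have e1 : ‖fc (U sj t a - T sj t a) ℓ‖ ≤ cV * ‖fc a ℓ‖ := hV1 j t hjt htj1 htT a hadf haoff
    have e2 : ‖fc (U sj t f) ℓ‖ ≤ cL * ‖f‖ := hLk j t hjt htj1 htT f hfdf hCPf hf1 hf2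
    have e3 : ‖fc (T sj t a) ℓ‖ ≤ ‖fc a ℓ‖ := hT1 sj t hsj0 hjt htT a hadf
    rw [hzt, hzaf, map_add, fc_add]
    have hsplit : fc (U sj t a) ℓ = fc (T sj t a) ℓ + fc (U sj t a - T sj t a) ℓ := by rw [fc_sub]; abel
    calc ‖fc (U sj t a) ℓ + fc (U sj t f) ℓ‖ ≤ ‖fc (U sj t a) ℓ‖ + ‖fc (U sj t f) ℓ‖ := norm_add_le _ _
      _ ≤ (‖fc (T sj t a) ℓ‖ + ‖fc (U sj t a - T sj t a) ℓ‖) + cL * ‖f‖ := by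
          rw [hsplit]; exact add_le_add (norm_add_le _ _) e2
      _ ≤ (‖fc a ℓ‖ + cV * ‖fc a ℓ‖) + cL * F j := add_le_add (add_le_add e3 e1) (mul_le_mul_of_nonneg_left hφ' hcL)
      _ = (1 + cV) * ‖fc z ℓ‖ + cL * F j := by rw [haℓ]; ring
      _ ≤ (1 + cV) * A j + cL * F j := by nlinarith [mul_le_mul_of_nonneg_left hα (add_nonneg zero_le_one hcV)]
  · -- sideband inside the window
    rw [hzt]
    have h1 := hFw j t hjt htj1 htT z hzdf hCPz
    have h2 : ‖z‖ ≤ Real.sqrt 2 * ‖fc z ℓ‖ + Real.sqrt (‖z‖ ^ 2 - (‖fc z ℓ‖ ^ 2 + ‖fc z (-ℓ)‖ ^ 2)) :=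
      norm_le_sqrt_two_mul_add_sqrt hℓ z
    calc _ ≤ cS * ‖z‖ + Real.sqrt (‖z‖ ^ 2 - (‖fc z ℓ‖ ^ 2 + ‖fc z (-ℓ)‖ ^ 2)) := h1
      _ ≤ cS * (Real.sqrt 2 * A j + F j) + F j := by
          have h3 : ‖z‖ ≤ Real.sqrt 2 * A j + F j :=
            h2.trans (add_le_add (mul_le_mul_of_nonneg_left hα (Real.sqrt_nonneg 2)) hφ)
          nlinarith [mul_le_mul_of_nonneg_left h3 hcS]
      _ = Real.sqrt 2 * cS * A j + (cS + 1) * F j := by ring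

end Iterate

end Summit.AnomalousDissipation.AnomalousDissipation.Theorems.SolenoidalFractalHomogenisation.LagrangianStep.VmodGen

end
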